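import Summits.ValiantsHypothesis.ValiantsHypothesis.Theorems.EquivariantDialPolyPermifyTransport
import Summits.ValiantsHypothesis.ValiantsHypothesis.Theorems.EquivariantDialNearExponentialHeads
import HarnessLib

/-!
# Equivariant dial — polynomial permify, file E: POLYNOMIAL PERMIFY, the diagonal cell at EXPONENTIAL
# rate, and every superlogarithmic diagonal head

Offer O-L1-29 «POLYNOMIAL PERMIFY» (decomposition workshop, lineage `decomp-val-lens-1`, g37; RULING bus 3382),
file E of five.  Dial (tree `…EquivariantDialNode.lean`): `EqHard H = ¬ PolyEquivariant H`; the diagonal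
notch `Δ𝔖_n = diagPermSubst n`; diagonal heads `Δ(𝔖_{t(m)} ⊕ 1) = diagHeadSubst t`.  State before this
file (g36, O-L1-28): permify at loss `(n+1)^{2τ}` per threshold, diagonal rate `2^{Ω(n / log n)}` i.o.,
`EqHard` for the heads `t(m) ≫ log₂ m · log₂ log₂ m` and all polylog heads `(log₂ m)^E`, `E ≥ 2`.

THIS FILE (the tree's threshold chain re-walked with the polynomial fixed-vector theorem of file D).
* ★ `diag_permify_poly` — POLYNOMIAL PERMIFY: a `Δ𝔖_n`-equivariant (exact `GL × GL` lifts) affine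
  determinantal representation of `per_n` of size `m` yields one of size `m' ≤ m · 4m · 1024 m^8` on
  which every diagonal substitution is undone by a permutation conjugation, unless `n ≤ 4 (log₂ m + 1)`
  (`diag_permify_of_budget` fed by `polyFixedVector`; no threshold, no `n`-dependence).
* ★★ `diag_rate_exp` — THE DIAGONAL CELL AT EXPONENTIAL RATE: every family of `Δ𝔖_n`-equivariant affine
  determinantal representations of the permanents of sizes `≤ 2^{L n}` has `n ≤ a (L n + 1)` for some
  `a` and infinitely many `n` — log-size `Ω(n)` infinitely often, matching Grenet's equivariant
  `2^n − 1` up to the constant in the exponent (symmetric circuits of `≤ 2^{e (10 L n + 14)}` gates via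
  `stub_toSymmetricCircuit`; Dawar–Wilsenach `squareSymmetricPermLB_holds`).
* ★ `exp_of_heredity`, ★★ `eqHard_of_expHeredity` — the heredity law at the new rate: a notch family
  with diagonal reach `b` and `log₂ (n + b n) = o(n)` carries no polynomial equivariant family.
* ★★ `eqHard_diagHead_superlog` — EVERY SUPERLOGARITHMIC DIAGONAL HEAD IS HARD: if
  `t(m) / log₂ m → ∞` (stated `∀ a, eventually a (log₂ m + 1) ≤ t m`) then `EqHard (Δ(𝔖_{t(m)} ⊕ 1))`
  — one theorem over `t`, reach `M n = min {m ≥ n : t m ≥ n}`; the special case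
  ★ `eqHard_diagHead_log_mul_loglog`: `t(m) = log₂ m · log₂ log₂ m`, the top edge of the g36 sliver.

LABEL (RULING bus 3382, verbatim). O-L1-29 (lens-1 g37): ELEMENTARY-COMBINATORIAL · NEW-COMBINATION leaning NEW-INPUT (𝔖_n-side: for EVERY λ ⊢
n a COMMUTING PAIR R′ ≤ R_λ, C′ ≤ C_λ with the explicit co-volume law n! ≤ (f^λ)^4·|R′|·|C′| by greedy
first-row/first-column peeling + the power-saving hook inequality (⋆G₄), and the MIXED Young eigenvector
B′_{C′}·c_λ, giving a subgroup R′·(C′ ∩ 𝔄_n) of index ≤ 2(f^λ)^4 fixing a nonzero Specht vector — a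
statement of Larsen–Shalev virtual-degree type (LS08 Thm 2.2: n!/Π aᵢ! bᵢ! = n·D(λ) ≤ n·d_λ^{1+o(1)} for the
FROBENIUS commuting pair, asymptotically sharper but with an ineffective threshold; Teyssier–Thévenin 2024
Thm 1.5: D(λ) ≤ d_λ^{1+C/ln n}) proved here in explicit all-n form by an elementary route and pointed at
equivariant determinantal symmetry for the first time × the g33–g36 permify / Dawar–Wilsenach rate /
heredity chain made budget-generic in O-L1-28) · PERMIFY BECOMES POLYNOMIAL: m′ ≤ 4096 m^10, no n-dependence
(g36: (n+1)^{2τ}, n^{O(log s)}); diagonal RATE edc_Δ(per_n) ≥ 2^{Ω(n)} i.o. (restricted Δ-model,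
Dawar–Wilsenach class, constant uncomputed; Grenet's 2^n − 1 matched up to the constant in the exponent,
g36: 2^{Ω(n/log n)}); HEAD LAW without the log factor: EVERY diagonal head Δ(𝔖_{t(m)} ⊕ 1) with t(m)/log₂ m
→ ∞ HARD·KERNEL (one theorem over t), instance t = log₂ m·log₂ log₂ m = the top edge of the g36 residual
sliver · the sliver narrows to log₂ m/log₂ log₂ m ≲ t ≲ C·log₂ m (contains t = log₂ m) and stays
UNDECIDED · IDEA-NEEDED — out of reach of every rate/permify engine modulo edc_Δ(per_n) = 2^{Θ(n)}: the
diagonal-head dial is EXHAUSTED for rate engines; index-law-beating, P-ROW and cyclic notches untouched ·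
0 S-currency · closes NO item · VP ≠ VNP untouched

HONEST BOUNDARY: 0 S-currency; closes NO item; `EqHard` conclusions are S-implied (S ⇒ W ⇒ EqHard H); the
rate conclusion n ≤ a(L n + 1) i.o. (edc_Δ(per_n) ≥ 2^{n/a − 1} infinitely often) is a restricted-model
lower bound of Dawar–Wilsenach class (Δ𝔖_n-equivariant = symmetric model) with an UNCOMPUTED constant a (it
depends on the Dawar–Wilsenach ε and the circuit-conversion exponent e, both ∃-packaged in the tree), not a
statement about dc(per_m); it matches Grenet's equivariant upper bound 2^n − 1 only up to that constant in
the exponent; permify is POLYNOMIAL in the matrix size (m′ ≤ 4096 m^10, exponent not optimised: the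
co-volume exponent 4 in n! ≤ (f^λ)^4 |R′||C′| is what the termwise scheme (⋆G₄) certifies, numerically 3
suffices); EVERY diagonal head with t(m)/log₂ m → ∞ is HARD·KERNEL, but the residual sliver log₂ m/log₂ log₂
m ≲ t(m) ≲ C·log₂ m (it contains t = log₂ m) stays UNDECIDED · IDEA-NEEDED and is out of reach of every
rate/permify engine unless edc_Δ(per_n) is 2^{ω(n)} (its heads have order t! = m^{Θ(log log m)}: above the
g33 index law, and a PolyEquivariant head t = C·log₂ m only produces Δ𝔖_n-ADRs of size 2^{O(n/C)}, below
what any 2^{Ω(n)}-class lower bound detects) — closing it needs an index-law-beating engine (or a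
superexponential Δ-lower bound, which nothing suggests); files D/E re-walk tree proofs
(alternating_fixed_vector, youngFixedVector_of_budget, diag_rate_nearExp, nearExp_of_heredity,
eqHard_of_nearExpHeredity) with the new subgroup family plugged in, the new mathematics is files A–C
(commuting pairs, (⋆G₄), the mixed eigenvector); P-ROW and the cyclic notches Δ⟨π⟩ of superpolynomial order
are NOT touched; stmt-23702 / VP ≠ VNP untouched.

References: [cite: DawarWilsenach2025, Thm. 7.1] (the symmetric-circuit lower bound, input);
[cite: LandsbergRessayre2017, Question 2.2] (equivariant determinantal complexity);
[cite: JamesKerber1981, 1.5 and 7.1] [cite: FrameRobinsonThrallCJM1954, Theorem 1] (files A–D).  Reused BY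
NAME: `diag_permify_of_budget`, `diag_permify` (small `n` only), `stub_toSymmetricCircuit`,
`squareSymmetricPermLB_holds`, `two_pow_add_two_pow_le`, `pow_add_le_two_pow_log`,
`hasEquivariantDetRepr_head`, `diagPermSubst_eq_map`, `diagReach_head`, `sqrt_log_eventually_lt`.
Theorems only; no definitions.
-/

set_option linter.dupNamespace false

noncomputable section

namespace Summit.ValiantsHypothesis.ValiantsHypothesis.Theorems.EquivariantDialPolyPermify

open MvPolynomial Matrix Literature.Computability.AlgebraicComplexity
open Literature.NumberTheory.DiophantineGeometry
open Summit.ValiantsHypothesis.ValiantsHypothesis.Theses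
open Summit.ValiantsHypothesis.ValiantsHypothesis.Theorems.EquivariantDialNode
open Summit.ValiantsHypothesis.ValiantsHypothesis.Theorems.EquivariantDialPolyIndex
open Summit.ValiantsHypothesis.ValiantsHypothesis.Theorems.EquivariantDialDiagonalPermify
open Summit.ValiantsHypothesis.ValiantsHypothesis.Theorems.EquivariantDialRateHeredity
open Summit.ValiantsHypothesis.ValiantsHypothesis.Theorems.EquivariantDialThresholdPermify
open Summit.ValiantsHypothesis.ValiantsHypothesis.Theorems.SymPencilEquivariantSdcNotQP.YoungBounds
open Summit.ValiantsHypothesis.ValiantsHypothesis.Theorems.SymPencilEquivariantSdcNotQP.Closer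

/-! ## §1 Polynomial permify -/

/-- ★ **POLYNOMIAL PERMIFY.**  A `Δ𝔖_n`-equivariant (exact `GL × GL` lifts) affine determinantal
representation of `per_n` of size `m` yields one of size `m' ≤ m · 4m · 1024 m^8` on which every diagonal
substitution is undone by a permutation conjugation — unless `n ≤ 4 (log₂ m + 1)` (small regime of the
spin dichotomy).  `diag_permify_of_budget` at the budget `1024 m^8` supplied by `polyFixedVector`
(`1024 k^8 ≤ 1024 m^8` for blocks `k ≤ m`). [folklore; cite: LandsbergRessayre2017, Def. 1.3] -/
theorem diag_permify_poly (n m : ℕ) (A : Matrix (Fin m) (Fin m) (MvPolynomial (Fin n × Fin n) ℂ))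
    (hA : IsEquivariantDetRepr (diagPermSubst n) (perPoly (Fin n) ℂ) A) :
    n ≤ 4 * (Nat.log 2 m + 1) ∨
      ∃ m' ≤ m * (4 * m * (1024 * m ^ 8)),
        ∃ A' : Matrix (Fin m') (Fin m') (MvPolynomial (Fin n × Fin n) ℂ),
          IsAffineDetRepr (perPoly (Fin n) ℂ) A' ∧
          ∀ σ : Equiv.Perm (Fin n), ∃ τ' : Equiv.Perm (Fin m'),
            A'.map (MvPolynomial.rename fun ij : Fin n × Fin n => (σ ij.1, σ ij.2)) =
              (τ'.permMatrix ℂ).map MvPolynomial.C * A' * ((τ'.permMatrix ℂ)ᵀ).map MvPolynomial.C :=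
  diag_permify_of_budget n m (1024 * m ^ 8) A hA fun k hk1 hkm σA => by
    obtain ⟨Y, hY, ℓ, hℓ, hfix⟩ := polyFixedVector n k σA hk1
    exact ⟨Y, hY.trans (Nat.mul_le_mul_left _ (Nat.pow_le_pow_left hkm 8)), ℓ, hℓ, hfix⟩

/-! ## §2 The diagonal cell at exponential rate -/

/-- Budget arithmetic of the polynomial chain: `s ≤ 2^L`, `m' ≤ s · 4s · 1024 s^8` give
`(m' + 2)^e ≤ 2^{e (10 L + 14)}`. [folklore] -/
theorem poly_size_bound {s L m' : ℕ} (e : ℕ) (hs : s ≤ 2 ^ L)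
    (hm' : m' ≤ s * (4 * s * (1024 * s ^ 8))) : (m' + 2) ^ e ≤ 2 ^ (e * (10 * L + 14)) := by
  have hk : m' ≤ 2 ^ (10 * L + 12) :=
    calc m' ≤ s * (4 * s * (1024 * s ^ 8)) := hm'
      _ ≤ 2 ^ L * (4 * 2 ^ L * (1024 * (2 ^ L) ^ 8)) :=
          Nat.mul_le_mul hs (Nat.mul_le_mul (Nat.mul_le_mul_left _ hs)
            (Nat.mul_le_mul_left _ (Nat.pow_le_pow_left hs 8)))
      _ = 2 ^ (10 * L + 12) := by ring
  calc (m' + 2) ^ e ≤ (2 ^ (10 * L + 12) + 2) ^ e := Nat.pow_le_pow_left (by omega) e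
    _ ≤ 2 ^ (e * (10 * L + 12 + 2)) := two_pow_add_two_pow_le _ e
    _ = 2 ^ (e * (10 * L + 14)) := by ring_nf

/-- ★★ **THE DIAGONAL CELL AT EXPONENTIAL RATE.**  Every family of `Δ𝔖_n`-equivariant (exact `GL × GL`
lifts) affine determinantal representations of the permanents of sizes `≤ 2^{L n}` satisfies
`n ≤ a (L n + 1)` for some `a` and infinitely many `n` — log-size `Ω(n)` infinitely often.  For `n` with
`4 (L n + 1) < n`, `diag_permify_poly` succeeds at size `≤ 2^{10 L n + 12}`, so `stub_toSymmetricCircuit`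
gives `𝔖_n`-symmetric circuits with `≤ 2^{e (10 L n + 14)}` gates; for the other `n` the quasi-polynomial
`diag_permify` supplies SOME symmetric circuit; Dawar–Wilsenach on the whole family.  Restricted-model
lower bound with an uncomputed constant; 0 S-currency; closes NO item.
[cite: DawarWilsenach2025, Thm. 7.1] [cite: LandsbergRessayre2017, Question 2.2] -/
theorem diag_rate_exp : ∀ L : ℕ → ℕ,
    (∀ n, ∃ s ≤ 2 ^ L n, HasEquivariantDetRepr (diagPermSubst n) (perPoly (Fin n) ℂ) s) →
    ∃ a : ℕ, ∀ n₀ : ℕ, ∃ n ≥ n₀, n ≤ a * (L n + 1) := by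
  intro L hL
  obtain ⟨d, hd⟩ := diag_permify
  obtain ⟨e, he⟩ := SymPencilEquivariantSdcNotQP.stub_toSymmetricCircuit
  have h₃ : ProofCarryingSymmetry.SquareSymmetricPermLB := squareSymmetricPermLB_holds
  -- Step 1: symmetric circuits for every `n`; of size `2^{e (10 L n + 14)}` whenever `4 (L n + 1) < n`
  have key : ∀ n : ℕ, ∃ (G : Type) (_ : Fintype G)
      (C : LabelledArithCircuit ℂ (Fin n × Fin n) Unit G),
      C.IsSymmetric (Equiv.Perm (Fin n)) ∧ C.eval (C.output ()) = perPoly (Fin n) ℂ ∧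
        (4 * (L n + 1) < n → Fintype.card G ≤ 2 ^ (e * (10 * L n + 14))) := by
    intro n
    obtain ⟨s, hs, A, hA⟩ := hL n
    have hlog : Nat.log 2 s ≤ L n :=
      (Nat.log_mono_right hs).trans_eq (Nat.log_pow Nat.one_lt_two _)
    rcases Nat.lt_or_ge (4 * (L n + 1)) n with hgood | hbad
    · rcases diag_permify_poly n s A hA with h1 | ⟨m', hm', A', hA', hperm⟩
      · exfalso
        have : n ≤ 4 * (L n + 1) := h1.trans (Nat.mul_le_mul_left _ (Nat.succ_le_succ hlog))
        omega
      · obtain ⟨G, hG, C, hCs, hCe, hcard⟩ := he n m' A' hA' hperm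
        exact ⟨G, hG, C, hCs, hCe, fun _ => hcard.trans (poly_size_bound e hs hm')⟩
    · obtain ⟨s', -, A', hA', hperm⟩ := hd n s A hA
      obtain ⟨G, hG, C, hCs, hCe, -⟩ := he n s' A' hA' hperm
      exact ⟨G, hG, C, hCs, hCe, fun h => absurd h (not_lt.mpr hbad)⟩
  choose G hG C hCs hCe hcard using key
  obtain ⟨ε, hε, hio⟩ := @h₃ G hG C hCs hCe
  -- Step 2: along Dawar–Wilsenach's infinite set, `ε n ≤ e (10 L n + 14)` (or `n` is small outright)
  refine ⟨14 * ⌈(e : ℝ) / ε⌉₊ + 4, fun n₀ => ?_⟩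
  obtain ⟨n, hn, hbig⟩ := hio n₀
  refine ⟨n, hn, ?_⟩
  rcases Nat.lt_or_ge (4 * (L n + 1)) n with hgood | hbad
  swap
  · calc n ≤ 4 * (L n + 1) := hbad
      _ ≤ (14 * ⌈(e : ℝ) / ε⌉₊ + 4) * (L n + 1) := Nat.mul_le_mul_right _ (by omega)
  set X : ℕ := 10 * L n + 14 with hX
  have hsizeR : (Fintype.card (G n) : ℝ) ≤ (2 : ℝ) ^ (((e * X : ℕ)) : ℝ) := by
    rw [Real.rpow_natCast]
    exact_mod_cast hcard n hgood
  have hchain := (Real.rpow_le_rpow_left_iff one_lt_two).1 (hbig.trans hsizeR)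
  have hnR : (n : ℝ) ≤ (⌈(e : ℝ) / ε⌉₊ : ℝ) * ((X : ℕ) : ℝ) := by
    have h1 : (n : ℝ) ≤ ((e * X : ℕ) : ℝ) / ε := by
      rw [le_div_iff₀ hε]
      linarith
    have h2 : ((e * X : ℕ) : ℝ) / ε = (e : ℝ) / ε * ((X : ℕ) : ℝ) := by
      push_cast
      ring
    rw [h2] at h1
    exact h1.trans (mul_le_mul_of_nonneg_right (Nat.le_ceil _) (by positivity))
  have hnN : n ≤ ⌈(e : ℝ) / ε⌉₊ * X := by exact_mod_cast hnR
  have hXle : X ≤ 14 * (L n + 1) := by omega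
  calc n ≤ ⌈(e : ℝ) / ε⌉₊ * X := hnN
    _ ≤ ⌈(e : ℝ) / ε⌉₊ * (14 * (L n + 1)) := Nat.mul_le_mul_left _ hXle
    _ = 14 * ⌈(e : ℝ) / ε⌉₊ * (L n + 1) := by ring
    _ ≤ (14 * ⌈(e : ℝ) / ε⌉₊ + 4) * (L n + 1) := Nat.mul_le_mul_right _ (by omega)

/-! ## §3 The heredity law at exponential rate -/

/-- ★ **EXPONENTIAL RATE HEREDITY.**  Head restriction along a diagonal reach `b` preserves sizes
(`hasEquivariantDetRepr_head`), so a `K`-equivariant family of sizes `≤ 2^{L m}` forces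
`n ≤ a (L (n + b n) + 1)` infinitely often. [folklore; cite: LandsbergRessayre2017, Question 2.2] -/
theorem exp_of_heredity
    (K : ∀ m : ℕ, Subgroup (Equiv.Perm (Fin m) × Equiv.Perm (Fin m))) (b L : ℕ → ℕ)
    (hK : ∀ n, ((⊤ : Subgroup (Equiv.Perm (Fin n))).map (diagHom n)).map
      ((headExt n (b n)).prodMap (headExt n (b n))) ≤ K (n + b n))
    (hL : ∀ m, ∃ s ≤ 2 ^ L m, HasEquivariantDetRepr ((K m).map (biPermHom m)) (perPoly (Fin m) ℂ) s) :
    ∃ a : ℕ, ∀ n₀ : ℕ, ∃ n ≥ n₀, n ≤ a * (L (n + b n) + 1) := by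
  refine diag_rate_exp (fun n => L (n + b n)) fun n => ?_
  obtain ⟨s, hs, hA⟩ := hL (n + b n)
  refine ⟨s, hs, ?_⟩
  rw [diagPermSubst_eq_map]
  exact hasEquivariantDetRepr_head n (b n) _ (Subgroup.map_mono (hK n)) hA

/-- ★★ **`EqHard` FROM EXPONENTIAL RATE HEREDITY.**  If `K` has diagonal reach `b` with
`log₂ (n + b n) = o(n)` (stated `∀ a, eventually a (log₂ (n + b n) + 1) < n`), then `per_m` has no
polynomial `K`-equivariant family: sizes `≤ m^c + c ≤ 2^{c (log₂ m + 1) + c + 1}` would give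
`n ≤ a (2c + 2)(log₂ (n + b n) + 1)` infinitely often (`exp_of_heredity`).  S-implied conclusion,
proved unconditionally in the restricted model. [folklore; cite: LandsbergRessayre2017, Question 2.2] -/
theorem eqHard_of_expHeredity
    (K : ∀ m : ℕ, Subgroup (Equiv.Perm (Fin m) × Equiv.Perm (Fin m))) (b : ℕ → ℕ)
    (hK : ∀ n, ((⊤ : Subgroup (Equiv.Perm (Fin n))).map (diagHom n)).map
      ((headExt n (b n)).prodMap (headExt n (b n))) ≤ K (n + b n))
    (ho : ∀ a : ℕ, ∃ n₀ : ℕ, ∀ n ≥ n₀, a * (Nat.log 2 (n + b n) + 1) < n) :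
    EqHard fun m => (K m).map (biPermHom m) := by
  intro hP
  obtain ⟨c, hc⟩ := hP
  obtain ⟨a, ha⟩ := exp_of_heredity K b (fun m => c * (Nat.log 2 m + 1) + c + 1) hK fun m => by
    obtain ⟨s, hs, hA⟩ := hc m
    exact ⟨s, hs.trans (pow_add_le_two_pow_log m c), hA⟩
  obtain ⟨n₀, hn₀⟩ := ho (a * (2 * c + 2))
  obtain ⟨n, hn, hle⟩ := ha n₀
  have hlt := hn₀ n hn
  have h1 : c * (Nat.log 2 (n + b n) + 1) + c + 1 + 1 ≤ (2 * c + 2) * (Nat.log 2 (n + b n) + 1) := by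
    nlinarith [Nat.zero_le (c * Nat.log 2 (n + b n)), Nat.zero_le (Nat.log 2 (n + b n))]
  have hmid : a * (c * (Nat.log 2 (n + b n) + 1) + c + 1 + 1) ≤
      a * (2 * c + 2) * (Nat.log 2 (n + b n) + 1) :=
    calc a * (c * (Nat.log 2 (n + b n) + 1) + c + 1 + 1)
        ≤ a * ((2 * c + 2) * (Nat.log 2 (n + b n) + 1)) := Nat.mul_le_mul_left _ h1
      _ = a * (2 * c + 2) * (Nat.log 2 (n + b n) + 1) := by ring
  exact absurd (hle.trans hmid) (not_le.mpr hlt)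

/-! ## §4 Every superlogarithmic diagonal head -/

/-- Growth lemma: `a (log₂ n + 1) < n` eventually (from the tree's `sqrt_log_eventually_lt`). [folklore] -/
theorem mul_log_succ_eventually_lt (a : ℕ) : ∃ n₀ : ℕ, ∀ n ≥ n₀, a * (Nat.log 2 n + 1) < n := by
  obtain ⟨n₀, hn₀⟩ := sqrt_log_eventually_lt a
  refine ⟨n₀, fun n hn => lt_of_le_of_lt ?_ (hn₀ n hn)⟩
  calc a * (Nat.log 2 n + 1) = a * 1 * (Nat.log 2 n + 1) := by ring
    _ ≤ a * (2 * (Nat.sqrt n + 1) + 1) * (Nat.log 2 n + 1) :=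
        Nat.mul_le_mul_right _ (Nat.mul_le_mul_left _ (by omega))

/-- ★★ **EVERY SUPERLOGARITHMIC DIAGONAL HEAD IS HARD.**  If `t(m) / log₂ m → ∞` — stated: for every
`a`, eventually `a (log₂ m + 1) ≤ t m` — then the permanents have no polynomial family of
`Δ(𝔖_{t(m)} ⊕ 1)`-equivariant (exact `GL × GL` lifts) affine determinantal representations.  Reach
`M n = min {m ≥ n : n ≤ t m}` (it exists since `t m ≥ log₂ m + 1 → ∞`); `log₂ (M n) = o(n)`: either
`M n = n`, or `M n − 1 ≥ n` is not admissible, so `2a (log₂ (M n − 1) + 1) ≤ t (M n − 1) < n`.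
`eqHard_of_expHeredity` with `diagReach_head`.  One theorem over `t`; previously (g36) only
`t ≫ log₂ m · log₂ log₂ m` and the polylog heads.  S-implied conclusion, proved unconditionally;
0 S-currency; closes NO item. [cite: DawarWilsenach2025, Thm. 7.1] [cite: LandsbergRessayre2017, Question 2.2] -/
theorem eqHard_diagHead_superlog (t : ℕ → ℕ)
    (ht : ∀ a : ℕ, ∃ m₀ : ℕ, ∀ m ≥ m₀, a * (Nat.log 2 m + 1) ≤ t m) :
    EqHard (diagHeadSubst t) := by
  classical
  -- the reach `M n = min {m ≥ n : n ≤ t m}`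
  have hex : ∀ n : ℕ, ∃ m : ℕ, n ≤ m ∧ n ≤ t m := by
    intro n
    obtain ⟨m₀, hm₀⟩ := ht 1
    refine ⟨max m₀ (2 ^ n), le_max_of_le_right Nat.lt_two_pow_self.le, ?_⟩
    have h := hm₀ (max m₀ (2 ^ n)) (le_max_left _ _)
    have h2 : n ≤ Nat.log 2 (max m₀ (2 ^ n)) :=
      calc n = Nat.log 2 (2 ^ n) := (Nat.log_pow Nat.one_lt_two n).symm
        _ ≤ Nat.log 2 (max m₀ (2 ^ n)) := Nat.log_mono_right (le_max_right _ _)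
    omega
  let M : ℕ → ℕ := fun n => Nat.find (hex n)
  have hM : ∀ n, n ≤ M n ∧ n ≤ t (M n) := fun n => Nat.find_spec (hex n)
  have hMmin : ∀ n m, m < M n → ¬ (n ≤ m ∧ n ≤ t m) := fun n m hm => Nat.find_min (hex n) hm
  have hb : ∀ n, n + (M n - n) = M n := fun n => Nat.add_sub_cancel' (hM n).1
  refine eqHard_of_expHeredity (fun m => (headPerms m (t m)).map (diagHom m)) (fun n => M n - n)
    (diagReach_head (t := t) _ fun n => ?_) fun a => ?_
  · show n ≤ t (n + (M n - n))
    rw [hb n]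
    exact (hM n).2
  · obtain ⟨m₀, hm₀⟩ := ht (2 * a)
    obtain ⟨n₁, hn₁⟩ := mul_log_succ_eventually_lt a
    refine ⟨max m₀ n₁, fun n hn => ?_⟩
    have hn0 : m₀ ≤ n := le_of_max_le_left hn
    have hn1 : n₁ ≤ n := le_of_max_le_right hn
    show a * (Nat.log 2 (n + (M n - n)) + 1) < n
    rw [hb n]
    rcases (hM n).1.eq_or_lt with h | h
    · rw [← h]
      exact hn₁ n hn1
    · -- `M n - 1 ≥ n` is not admissible
      have hge : n ≤ M n - 1 := by omega
      have htlt : t (M n - 1) < n := by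
        by_contra hc
        exact hMmin n (M n - 1) (by omega) ⟨hge, not_lt.mp hc⟩
      have h2a := hm₀ (M n - 1) (hn0.trans hge)
      have hlog : Nat.log 2 (M n) < Nat.log 2 (M n - 1) + 2 := by
        refine Nat.log_lt_of_lt_pow (by omega) ?_
        have h3 := Nat.lt_pow_succ_log_self Nat.one_lt_two (M n - 1)
        calc M n ≤ 2 * (M n - 1) := by omega
          _ < 2 * 2 ^ (Nat.log 2 (M n - 1) + 1) := Nat.mul_lt_mul_of_pos_left h3 Nat.two_pos
          _ = 2 ^ (Nat.log 2 (M n - 1) + 2) := by ring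
      calc a * (Nat.log 2 (M n) + 1) ≤ a * (Nat.log 2 (M n - 1) + 2) :=
            Nat.mul_le_mul_left _ (by omega)
        _ ≤ 2 * a * (Nat.log 2 (M n - 1) + 1) := by nlinarith [Nat.zero_le (a * Nat.log 2 (M n - 1))]
        _ ≤ t (M n - 1) := h2a
        _ < n := htlt

/-- ★ **The head `t(m) = log₂ m · log₂ log₂ m` is hard** — the top edge of the g36 residual sliver, now
inside the HARD·KERNEL region: for `m ≥ 2^{2^{2a}}`, `log₂ log₂ m ≥ 2a` and
`a (log₂ m + 1) ≤ 2a log₂ m ≤ log₂ m · log₂ log₂ m`.  S-implied conclusion, proved unconditionally;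
0 S-currency; closes NO item. [cite: DawarWilsenach2025, Thm. 7.1] [cite: LandsbergRessayre2017, Question 2.2] -/
theorem eqHard_diagHead_log_mul_loglog :
    EqHard (diagHeadSubst fun m => Nat.log 2 m * Nat.log 2 (Nat.log 2 m)) := by
  refine eqHard_diagHead_superlog _ fun a => ⟨2 ^ 2 ^ (2 * a), fun m hm => ?_⟩
  have hL : 2 ^ (2 * a) ≤ Nat.log 2 m :=
    calc 2 ^ (2 * a) = Nat.log 2 (2 ^ 2 ^ (2 * a)) := (Nat.log_pow Nat.one_lt_two _).symm
      _ ≤ Nat.log 2 m := Nat.log_mono_right hm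
  have hLL : 2 * a ≤ Nat.log 2 (Nat.log 2 m) :=
    calc 2 * a = Nat.log 2 (2 ^ (2 * a)) := (Nat.log_pow Nat.one_lt_two _).symm
      _ ≤ Nat.log 2 (Nat.log 2 m) := Nat.log_mono_right hL
  have hL1 : 1 ≤ Nat.log 2 m := Nat.one_le_two_pow.trans hL
  show a * (Nat.log 2 m + 1) ≤ Nat.log 2 m * Nat.log 2 (Nat.log 2 m)
  calc a * (Nat.log 2 m + 1) ≤ a * (2 * Nat.log 2 m) := Nat.mul_le_mul_left _ (by omega)
    _ = Nat.log 2 m * (2 * a) := by ring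
    _ ≤ Nat.log 2 m * Nat.log 2 (Nat.log 2 m) := Nat.mul_le_mul_left _ hLL

end Summit.ValiantsHypothesis.ValiantsHypothesis.Theorems.EquivariantDialPolyPermify

end
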